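import Mathlib
import Summits.NavierStokesRegularity.NavierStokesRegularity.Theorems.FilamentSkeletonRssDefectColumnGateDefsRacc
import Summits.NavierStokesRegularity.NavierStokesRegularity.Theorems.FilamentSkeletonRssDefectColumnGateClosingIVT
import Summits.NavierStokesRegularity.NavierStokesRegularity.Theorems.FilamentSkeletonRssDefectColumnGateParamContinuity

/-!
# Route `FilamentSkeletonRss` · ∀-crux `TransverseReduction1AR` (stmt-NavierStokesRegularity-23611) · line `defect_column_gate_1AR` → «A1R-acc»:
# STUB S3-acc `stub_defectClosingAcc : DefectClosingAcc` — PROVED (S3 ported ONE DIMENSION UP: box × window, `N + 1` multipliers, no IVT)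

Helper file (theorems only), `--supports stmt-NavierStokesRegularity-23611 --as helper`; LEAD of 23611, lane ns-filament-21221-p1 g13.  Statement = `DefectClosingAcc` of
the line-side vocabulary `…DefectColumnGateDefsRacc` (v3).  HONEST FRAMING: the closing step of a HYPOTHETICAL filament-type rotating-self-similar blow-up route in its
«reduction modulo accretion modes» form (director-ns dss_120 KEEP-R4 branch; MODEL rung, negative side).  Nothing here bears on Navier–Stokes regularity; the A1R-acc
items are not filed; `TransverseReduction1AR` is neither proved nor refuted.

Proof (p646026/p646054 one dimension up).  Fix the box, `Cs`, `k₀ > 0`, `κ, C₂, q₀, k₀'`.  Take `q₁ := q₀`, `k := max (max k₀' 1) (⌈2|κ| + |q₀|⌉₊ + 2)`, and for `C_r` the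
threshold `Γ₁ := max 1 (64C₂²|C_r| + 4|C₂||C_r| + 4|C₂||C_r|/η + 2)` (`closing_thresholds`; also `Γ·2C₂Γ^κ·C_rΓ^{−k} ≤ 1`, `closing_threshold_export`).  For `Γ ≥ Γ₁`, a
p-family, an S1-acc family (`FamilySpecAcc`) and an S2-acc gate (`DefectGateSpecAcc`): at every `(p, β)` of cube × window the landed Picard iteration gives the fixed point
`G_{p,β} = −r − D(𝓚G)[𝓚G]` in the `2ε`-ball; the outputs over the ABSTRACT window `b ∈ [−1, 1]` (`β = β₀b`) are `αo := α⁰_p + β₀b`, `U := U⁰ + 𝓚G`, `P := P⁰ + 𝓠G`,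
`g' := σ·(g − 𝓫G)`, `Zr := σ·Z` (`σ = ±1` the family's orientation), `B_j := G_j − 𝓬_jG`, `k' := kA`.  Then: the equation holds modulo `g'·Zr + Σ_j B_j·D_pj`
(`E(U⁰+W) + ∇(P⁰+Q) = (r + gZ + ΣG_jD_j) + (G − 𝓫G·Z − Σ𝓬_jG·D_j) + DW[W]`); `(g', B)` is JOINTLY CONTINUOUS on the box — `g, G_j` by the family's local continuity,
`𝓫G, 𝓬_jG` by `continuousOn_functional_fixedPoint` (p678336) instantiated `N + 1` times on the parameter set `cube ×ˢ [−β₀, β₀] ⊆ (Fin N → ℝ) × ℝ`, then pulled back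
along `(p, b) ↦ (p, β₀b)`; the rate faces `g'(p, −1) < 0 < g'(p, 1)` from the family's margins `∓Γ^{−q₁}` and `|𝓫G| < Γ^{−q₁}`; the export law transfers with
`Ce = Cs + 1` since `Γ·|𝓬_jG| ≤ Γ·2C₂C_rΓ^{κ−k} ≤ 1`; `αo ≠ 0`, `U ≠ 0`, decay, pressure and waist envelopes as in `almostConcl_of_balanced`.
-/

set_option linter.dupNamespace false

noncomputable section

namespace Summit.NavierStokesRegularity.NavierStokesRegularity.Theorems.DefectColumnGate

open scoped BigOperators Topology InnerProductSpace ContDiff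
open Filter Set Function MeasureTheory Metric
open Literature.Analysis.FluidPDE
open Summit.NavierStokesRegularity.NavierStokesRegularity.Theses.FilamentSkeletonRss
open Summit.NavierStokesRegularity.NavierStokesRegularity.Theorems.KelvinGate

/-! ## One more threshold: the export transfer -/

/-- For `Γ ≥ 1`, `k ≥ κ + 2` and `Γ ≥ 2|C₂||C_r|`: `Γ · (C₂Γ^κ · 2C_rΓ^{−k}) ≤ 1` (the accretion coefficients of the fixed-point forcing cost at most `1/Γ`). -/
theorem closing_threshold_export {Γ κ C₂ Cr : ℝ} {k : ℕ} (hΓ1 : 1 ≤ Γ) (hk : κ + 2 ≤ (k:ℝ)) (hΓbig : 2 * |C₂| * |Cr| ≤ Γ) :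
    Γ * (C₂ * Γ ^ κ * (2 * (Cr * Γ ^ (-(k:ℝ))))) ≤ 1 := by
  have hΓ0 : 0 < Γ := by linarith
  have e : Γ * (C₂ * Γ ^ κ * (2 * (Cr * Γ ^ (-(k:ℝ))))) = 2 * (C₂ * Cr) * (Γ ^ (1:ℝ) * Γ ^ κ * Γ ^ (-(k:ℝ))) := by
    rw [Real.rpow_one]; ring
  have e2 : Γ ^ (1:ℝ) * Γ ^ κ * Γ ^ (-(k:ℝ)) = Γ ^ (1 + κ + -(k:ℝ)) := by
    rw [Real.rpow_add hΓ0, Real.rpow_add hΓ0]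
  have hexp : Γ ^ (1 + κ + -(k:ℝ)) ≤ Γ⁻¹ := by
    rw [← Real.rpow_neg_one]; exact Real.rpow_le_rpow_of_exponent_le hΓ1 (by linarith)
  have hACr : C₂ * Cr ≤ |C₂| * |Cr| := by rw [← abs_mul]; exact le_abs_self _
  rw [e, e2]
  calc 2 * (C₂ * Cr) * Γ ^ (1 + κ + -(k:ℝ)) ≤ 2 * (|C₂| * |Cr|) * Γ ^ (1 + κ + -(k:ℝ)) :=
        mul_le_mul_of_nonneg_right (by linarith) (Real.rpow_nonneg hΓ0.le _)
    _ ≤ 2 * (|C₂| * |Cr|) * Γ⁻¹ := mul_le_mul_of_nonneg_left hexp (by positivity)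
    _ = (2 * |C₂| * |Cr|) / Γ := by rw [div_eq_mul_inv]; ring
    _ ≤ 1 := by rw [div_le_one hΓ0]; exact hΓbig

/-! ## Conclusion bookkeeping at one parameter: equation MODULO the rate column and the accretion modes -/

/-- **Bookkeeping at one `(p, β)`.**  A smooth divergence-free base `(U⁰, P⁰)` of X-size `CsΓ⁴` with residual `E_a(U⁰) + ∇P⁰ = r + g·Z + Σ_j G_j·D_j`, a bordered
solve `𝓛W + ∇Q + 𝓫·Z + Σ_j 𝓬_j·D_j = G` with `X(W), |Q| ≤ 2Aε`, and the fixed-point relation `G = −r − DW[W]` give, for any sign `σ` with `σ·σ = 1`: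
`E_a(U⁰ + W) + ∇(P⁰ + Q) = (σ(g − 𝓫))·(σZ) + Σ_j (G_j − 𝓬_j)·D_j`, `U⁰ + W ≠ 0` (unit of mass at `y₀` vs `2Aε ≤ ½`), decay `(CsΓ⁴ + 2Aε)/(1+‖y‖)`, pressure bound,
and waist closeness `η√Γ` (from `η√Γ/2 + 2Aε`). -/
theorem boxConcl_point_of_fixedPoint {N : ℕ} {Γ ρ η Rw Cs A ε a : ℝ} {X : Fin N → ℝ → EuclideanSpace ℝ (Fin 3)}
    {u : (Fin N → ℝ → EuclideanSpace ℝ (Fin 3)) → EuclideanSpace ℝ (Fin 3) → EuclideanSpace ℝ (Fin 3)}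
    {U0 W Z r G : EuclideanSpace ℝ (Fin 3) → EuclideanSpace ℝ (Fin 3)} {P0 Q : EuclideanSpace ℝ (Fin 3) → ℝ}
    {D : Fin N → EuclideanSpace ℝ (Fin 3) → EuclideanSpace ℝ (Fin 3)} {g 𝓫 σ : ℝ} {Gc 𝓬 : Fin N → ℝ}
    (hU0s : ContDiff ℝ (⊤:ℕ∞) U0) (hP0s : ContDiff ℝ (⊤:ℕ∞) P0) (hdiv0 : VectorCalculus.IsDivFree U0) (hU0X : XBound U0 (Cs * Γ ^ 4))
    (hP0b : ∀ y, |P0 y| ≤ Cs * Γ ^ 4) (hy₀ : ∃ y₀, ‖y₀‖ ≤ Cs ∧ 1 ≤ ‖U0 y₀‖)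
    (hwaist : ∀ y, ‖y‖ ≤ Rw * √Γ → (∀ j τ, ρ * √Γ / 4 ≤ ‖y - X j τ‖) → ‖U0 y - u X y‖ ≤ η * √Γ / 2)
    (hres : ∀ y, lerayOp a U0 y + gradient P0 y = r y + g • Z y + ∑ j, Gc j • D j y)
    (hW : XBound W (A * (2 * ε))) (hQ1 : ContDiff ℝ 1 Q) (hQb : ∀ y, |Q y| ≤ A * (2 * ε)) (hdivW : VectorCalculus.IsDivFree W)
    (heq : ∀ y, lerayLin a U0 W y + gradient Q y + 𝓫 • Z y + ∑ j, 𝓬 j • D j y = G y)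
    (hfix : ∀ y, G y = -r y - fderiv ℝ W y (W y)) (hσ : σ * σ = 1)
    (hhalf : 2 * A * ε ≤ 1 / 2) (hηΓ : 2 * A * ε ≤ η * √Γ / 2) :
    (fun z => U0 z + W z) ≠ 0 ∧ ContDiff ℝ 2 (fun z => U0 z + W z) ∧ ContDiff ℝ 1 (fun z => P0 z + Q z) ∧ VectorCalculus.IsDivFree (fun z => U0 z + W z) ∧
    (∀ y, lerayOp a (fun z => U0 z + W z) y + gradient (fun z => P0 z + Q z) y = (σ * (g - 𝓫)) • (σ • Z y) + ∑ j, (Gc j - 𝓬 j) • D j y) ∧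
    (∀ y, ‖U0 y + W y‖ ≤ (Cs * Γ ^ 4 + 2 * A * ε) / (1 + ‖y‖)) ∧ (∀ y, |P0 y + Q y| ≤ Cs * Γ ^ 4 + 2 * A * ε) ∧
    (∀ y, ‖y‖ ≤ Rw * √Γ → (∀ j τ, ρ * √Γ / 4 ≤ ‖y - X j τ‖) → ‖U0 y + W y - u X y‖ ≤ η * √Γ) := by
  obtain ⟨y₀, -, hy₀⟩ := hy₀
  have hU02 : ContDiff ℝ 2 U0 := hU0s.of_le (WithTop.coe_le_coe.mpr (le_top : ((2 : ℕ) : ℕ∞) ≤ ⊤))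
  have hP01 : ContDiff ℝ 1 P0 := hP0s.of_le (WithTop.coe_le_coe.mpr (le_top : ((1 : ℕ) : ℕ∞) ≤ ⊤))
  have hWb : ∀ y, ‖W y‖ ≤ 2 * A * ε := fun y => by
    have h1 := (hW.2 y).1
    have h2 : ‖W y‖ ≤ (1 + ‖y‖) * ‖W y‖ := le_mul_of_one_le_left (norm_nonneg _) (by linarith [norm_nonneg y])
    linarith
  refine ⟨?_, hU02.add hW.1, hP01.add hQ1, ?_, fun y => ?_, fun y => ?_, fun y => ?_, fun y hy htube => ?_⟩
  · -- `U ≠ 0`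
    intro hzero
    have h0 : U0 y₀ + W y₀ = 0 := by simpa using congrFun hzero y₀
    have hW0 : ‖W y₀‖ ≤ 1 / 2 := (hWb y₀).trans hhalf
    have : U0 y₀ = -W y₀ := eq_neg_of_add_eq_zero_left h0
    rw [this, norm_neg] at hy₀
    linarith
  · exact isDivFree_add hdiv0 hdivW (hU02.differentiable (by norm_num)) (hW.1.differentiable (by norm_num))
  · -- the profile equation modulo the `N + 1` modes, pointwise
    have hQd : DifferentiableAt ℝ Q y := (hQ1.differentiable (by norm_num)) y
    rw [lerayOp_add_eq a U0 W y hU02.contDiffAt hW.1.contDiffAt, gradient_fun_add' ((hP01.differentiable (by norm_num)) y) hQd]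
    have e : lerayOp a U0 y + lerayLin a U0 W y + fderiv ℝ W y (W y) + (gradient P0 y + gradient Q y) =
        (lerayOp a U0 y + gradient P0 y) + (lerayLin a U0 W y + gradient Q y) + fderiv ℝ W y (W y) := by abel
    have heq' : lerayLin a U0 W y + gradient Q y = G y - 𝓫 • Z y - ∑ j, 𝓬 j • D j y := by
      rw [← heq y]; abel
    have hσσ : (σ * (g - 𝓫)) • (σ • Z y) = (g - 𝓫) • Z y := by
      rw [smul_smul, show σ * (g - 𝓫) * σ = (g - 𝓫) * (σ * σ) by ring, hσ, mul_one]
    rw [e, hres y, heq', hfix y, hσσ, sub_smul]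
    simp only [sub_smul, Finset.sum_sub_distrib]
    abel
  · -- decay
    have hy1 : 0 < 1 + ‖y‖ := by positivity
    rw [le_div_iff₀ hy1]
    have h1 : ‖U0 y‖ * (1 + ‖y‖) ≤ Cs * Γ ^ 4 := by rw [mul_comm]; exact (hU0X.2 y).1
    have h2 : ‖W y‖ * (1 + ‖y‖) ≤ 2 * A * ε := by
      have := (hW.2 y).1; rw [mul_comm] at this; linarith
    calc ‖U0 y + W y‖ * (1 + ‖y‖) ≤ (‖U0 y‖ + ‖W y‖) * (1 + ‖y‖) :=
          mul_le_mul_of_nonneg_right (norm_add_le _ _) hy1.le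
      _ = ‖U0 y‖ * (1 + ‖y‖) + ‖W y‖ * (1 + ‖y‖) := by ring
      _ ≤ Cs * Γ ^ 4 + 2 * A * ε := by linarith
  · calc |P0 y + Q y| ≤ |P0 y| + |Q y| := abs_add_le _ _
      _ ≤ Cs * Γ ^ 4 + 2 * A * ε := by linarith [hP0b y, hQb y]
  · calc ‖U0 y + W y - u X y‖ = ‖(U0 y - u X y) + W y‖ := by abel_nf
      _ ≤ ‖U0 y - u X y‖ + ‖W y‖ := norm_add_le _ _
      _ ≤ η * √Γ / 2 + η * √Γ / 2 := add_le_add (hwaist y hy htube) ((hWb y).trans hηΓ)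
      _ = η * √Γ := by ring

/-! ## Continuity pulled back along the window rescaling -/

/-- Membership bookkeeping for the physical parameter set `cube ×ˢ [−β₀, β₀]`. -/
theorem mem_cubeWindow_iff {N : ℕ} {β₀ : ℝ} (π : (Fin N → ℝ) × ℝ) :
    π ∈ ({p : Fin N → ℝ | ∀ i, p i ∈ Icc (0:ℝ) 1} ×ˢ Icc (-β₀) β₀) ↔ (∀ i, π.1 i ∈ Icc (0:ℝ) 1) ∧ |π.2| ≤ β₀ := by
  rw [mem_prod, mem_setOf_eq, mem_Icc, abs_le]

/-- Product distance bookkeeping: `dist π' π < δ` in `(Fin N → ℝ) × ℝ` gives `dist p' p < δ` and `|β' − β| < δ`. -/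
theorem dist_cubeWindow_lt {N : ℕ} {π π' : (Fin N → ℝ) × ℝ} {δ : ℝ} (h : dist π' π < δ) : dist π'.1 π.1 < δ ∧ |π'.2 - π.2| < δ := by
  rw [Prod.dist_eq, max_lt_iff, Real.dist_eq] at h
  exact h

/-! ## The stub -/

/-- **STUB S3-acc `DefectClosingAcc` OF THE A1R-acc LINE, PROVED** (statement `…DefsRacc.DefectClosingAcc`, by name). -/
theorem stub_defectClosingAcc : DefectClosingAcc := by
  intro N δ ρ K Λ a b cnd η Rw Rb cg θ₀ KA hN hδ hρ ha hη hRw hRb hcg hθ₀ Cs k₀ κ C₂ q₀ k₀' hk₀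
  refine ⟨q₀, le_rfl, max (max k₀' 1) (⌈2 * |κ| + |q₀|⌉₊ + 2), le_trans (le_max_left _ _) (le_max_left _ _),
    le_trans (le_max_right _ _) (le_max_left _ _), ?_⟩
  set k : ℕ := max (max k₀' 1) (⌈2 * |κ| + |q₀|⌉₊ + 2) with hk
  intro Cr
  refine ⟨max 1 (64 * C₂ ^ 2 * |Cr| + 4 * |C₂| * |Cr| + 4 * |C₂| * |Cr| / η + 2), ?_⟩
  intro Γ hΓ γ α X w c m n Aa u v A T D hu hv hA hT hD hcl α0 β₀ U0 P0 Z g Gc kA r hfam 𝓚 𝓠 𝓫 𝓬 hgate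
  classical
  have hΓ1 : 1 ≤ Γ := le_trans (le_max_left _ _) hΓ
  have hΓbig : 64 * C₂ ^ 2 * |Cr| + 4 * |C₂| * |Cr| + 4 * |C₂| * |Cr| / η + 2 ≤ Γ := le_trans (le_max_right _ _) hΓ
  have hΓ0 : 0 < Γ := by linarith
  -- the order `k`
  have hk1 : 1 ≤ k := le_trans (le_max_right _ _) (le_max_left _ _)
  have hkR : 2 * |κ| + |q₀| + 2 ≤ (k:ℝ) := by
    have h1 : ((⌈2 * |κ| + |q₀|⌉₊ + 2 : ℕ) : ℝ) ≤ (k:ℝ) := by exact_mod_cast le_max_right (max k₀' 1) (⌈2 * |κ| + |q₀|⌉₊ + 2)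
    push_cast at h1
    linarith [Nat.le_ceil (2 * |κ| + |q₀|)]
  have hk2κ : 2 * κ + 1 ≤ (k:ℝ) := by linarith [le_abs_self κ, abs_nonneg q₀]
  have hkq : κ - (k:ℝ) + q₀ ≤ -2 := by linarith [le_abs_self κ, le_abs_self q₀, abs_nonneg κ]
  have hkκ2 : κ + 2 ≤ (k:ℝ) := by linarith [le_abs_self κ, abs_nonneg q₀, abs_nonneg κ]
  -- the cube and the family facts
  set cube : Set (Fin N → ℝ) := {p : Fin N → ℝ | ∀ i, p i ∈ Icc (0:ℝ) 1} with hcube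
  obtain ⟨hβ₀, hβθ, -, hsign, hfamp⟩ := id hfam
  obtain ⟨hg12, htight, hgc⟩ := id hgate
  let p₀ : Fin N → ℝ := fun _ => 0
  have hp₀ : ∀ i, p₀ i ∈ Icc (0:ℝ) 1 := fun _ => ⟨le_rfl, zero_le_one⟩
  have habs1 : |(-β₀)| ≤ β₀ := by rw [abs_neg, abs_of_pos hβ₀]
  have habs2 : |β₀| ≤ β₀ := by rw [abs_of_pos hβ₀]
  have hres : ∀ p : Fin N → ℝ, (∀ i, p i ∈ Icc (0:ℝ) 1) → ∀ β : ℝ, |β| ≤ β₀ → YBound (r p β) (Cr * Γ ^ (-(k:ℝ))) :=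
    fun p hp β hβ => ((hfamp p hp).2.1 β hβ).2.2.2.2.2.2.2.2.2.2.1
  have hCr : 0 ≤ Cr := by
    have hε0 : 0 ≤ Cr * Γ ^ (-(k:ℝ)) := (hres p₀ hp₀ β₀ habs2).nonneg
    have hpos : 0 < Γ ^ (-(k:ℝ)) := Real.rpow_pos_of_pos hΓ0 _
    by_contra hneg
    push Not at hneg
    have : Cr * Γ ^ (-(k:ℝ)) < 0 := mul_neg_of_neg_of_pos hneg hpos
    linarith
  obtain ⟨h64, hhalf, hηΓ, hbq⟩ := closing_thresholds hΓ1 hk2κ hk1 hkq hη hCr hΓbig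
  have hexport : Γ * (C₂ * Γ ^ κ * (2 * (Cr * Γ ^ (-(k:ℝ))))) ≤ 1 := by
    have hCrabs : |Cr| = Cr := abs_of_nonneg hCr
    refine closing_threshold_export hΓ1 hkκ2 ?_
    have : 0 ≤ 64 * C₂ ^ 2 * |Cr| := by positivity
    have : 0 ≤ 4 * |C₂| * |Cr| / η := by positivity
    linarith
  set ε : ℝ := Cr * Γ ^ (-(k:ℝ)) with hε
  set Ag : ℝ := C₂ * Γ ^ κ with hAg
  have hε0 : 0 ≤ ε := (hres p₀ hp₀ β₀ habs2).nonneg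
  have h16 : 16 * Ag ^ 2 * ε ≤ 1 := by nlinarith [sq_nonneg Ag]
  have hhalf' : 2 * Ag * ε ≤ 1 / 2 := by rw [hAg, hε]; linarith
  have hηΓ' : 2 * Ag * ε ≤ η * √Γ / 2 := by rw [hAg, hε]; linarith
  -- gate clauses (1) and (2), split
  have hK1 : ∀ p : Fin N → ℝ, (∀ i, p i ∈ Icc (0:ℝ) 1) → ∀ β : ℝ, |β| ≤ β₀ → ∀ (F : EuclideanSpace ℝ (Fin 3) → EuclideanSpace ℝ (Fin 3)) (R : ℝ), YBound F R →
      XBound (𝓚 p β F) (Ag * R) := fun p hp β hβ F R hF => ((hg12 p hp β hβ).1 F R hF).1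
  have hK2 : ∀ p : Fin N → ℝ, (∀ i, p i ∈ Icc (0:ℝ) 1) → ∀ β : ℝ, |β| ≤ β₀ → ∀ (F G : EuclideanSpace ℝ (Fin 3) → EuclideanSpace ℝ (Fin 3)) (s : ℝ), (∃ R, YBound F R) →
      (∃ R, YBound G R) → 𝓚 p β (fun y => F y + s • G y) = fun y => 𝓚 p β F y + s • 𝓚 p β G y :=
    fun p hp β hβ F G s hF hG => ((hg12 p hp β hβ).2 F G s hF hG).1
  have hA0 : 0 ≤ Ag := by
    have h := (hK1 p₀ hp₀ β₀ habs2 (fun _ => 0) 1 (yBound_zero.mono zero_le_one)).nonneg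
    linarith
  -- per-(p,β) frozen Picard
  have hpic : ∀ p : Fin N → ℝ, (∀ i, p i ∈ Icc (0:ℝ) 1) → ∀ β : ℝ, |β| ≤ β₀ → ∃ F : EuclideanSpace ℝ (Fin 3) → EuclideanSpace ℝ (Fin 3),
      YBound F (2 * ε) ∧ ∀ y, F y = -r p β y - fderiv ℝ (𝓚 p β F) y (𝓚 p β F y) :=
    fun p hp β hβ => picard_exists_fixedPoint (K := 𝓚 p β) (A := Ag) (hK1 p hp β hβ) (hK2 p hp β hβ) (hres p hp β hβ) h16
  choose! G hG using hpic
  -- bounds on the multipliers of the fixed-point forcing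
  have hbB : ∀ p : Fin N → ℝ, (∀ i, p i ∈ Icc (0:ℝ) 1) → ∀ β : ℝ, |β| ≤ β₀ → |𝓫 p β (G p β)| ≤ Ag * (2 * ε) :=
    fun p hp β hβ => ((hg12 p hp β hβ).1 (G p β) _ (hG p hp β hβ).1).2.2.2.1
  have hcB : ∀ p : Fin N → ℝ, (∀ i, p i ∈ Icc (0:ℝ) 1) → ∀ β : ℝ, |β| ≤ β₀ → ∀ j, |𝓬 p β (G p β) j| ≤ Ag * (2 * ε) :=
    fun p hp β hβ j => ((hg12 p hp β hβ).1 (G p β) _ (hG p hp β hβ).1).2.2.2.2.1 j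
  have hbq' : ∀ p : Fin N → ℝ, (∀ i, p i ∈ Icc (0:ℝ) 1) → ∀ β : ℝ, |β| ≤ β₀ → |𝓫 p β (G p β)| < Γ ^ (-q₀) :=
    fun p hp β hβ => lt_of_le_of_lt (hbB p hp β hβ) hbq
  -- the orientation sign
  set σ : ℝ := if (∀ p : Fin N → ℝ, (∀ i, p i ∈ Icc (0:ℝ) 1) → g p (-β₀) ≤ -Γ ^ (-q₀) ∧ Γ ^ (-q₀) ≤ g p β₀) then 1 else -1 with hσdef
  have hσ : σ * σ = 1 := by
    rw [hσdef]; split_ifs <;> norm_num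
  -- the window rescaling
  have hwin : ∀ b' : ℝ, b' ∈ Icc (-1:ℝ) 1 → |β₀ * b'| ≤ β₀ := by
    intro b' hb'
    rw [abs_mul, abs_of_pos hβ₀]
    have : |b'| ≤ 1 := abs_le.mpr ⟨hb'.1, hb'.2⟩
    nlinarith
  -- THE OUTPUTS
  refine ⟨Cs * Γ ^ 4 + 2 * Ag * ε, Cs * Γ ^ 4 + 2 * Ag * ε, fun p b' => α0 p + β₀ * b',
    fun p b' => σ * (g p (β₀ * b') - 𝓫 p (β₀ * b') (G p (β₀ * b'))),
    fun p b' j => Gc p (β₀ * b') j - 𝓬 p (β₀ * b') (G p (β₀ * b')) j, fun p b' j => kA p (β₀ * b') j,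
    fun p b' y => σ • Z p (β₀ * b') y, fun p b' y => U0 p (β₀ * b') y + 𝓚 p (β₀ * b') (G p (β₀ * b')) y,
    fun p b' y => P0 p (β₀ * b') y + 𝓠 p (β₀ * b') (G p (β₀ * b')) y, ?_, ?_, ?_⟩
  · /- JOINT CONTINUITY of `(g', B)` on `cube ×ˢ [−1, 1]`: first on the physical parameter set `S = cube ×ˢ [−β₀, β₀]`, then pulled back
       along `(p, b) ↦ (p, β₀b)`. -/
    set S : Set ((Fin N → ℝ) × ℝ) := cube ×ˢ Icc (-β₀) β₀ with hS
    have hSm : ∀ π : (Fin N → ℝ) × ℝ, π ∈ S → (∀ i, π.1 i ∈ Icc (0:ℝ) 1) ∧ |π.2| ≤ β₀ := fun π hπ => (mem_cubeWindow_iff π).mp hπ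
    -- the abstract continuity theorem's hypotheses, on `S`
    have aK1 : ∀ π ∈ S, ∀ (F : EuclideanSpace ℝ (Fin 3) → EuclideanSpace ℝ (Fin 3)) (R : ℝ), YBound F R → XBound (𝓚 π.1 π.2 F) (Ag * R) :=
      fun π hπ => hK1 π.1 (hSm π hπ).1 π.2 (hSm π hπ).2
    have aK2 : ∀ π ∈ S, ∀ (F G : EuclideanSpace ℝ (Fin 3) → EuclideanSpace ℝ (Fin 3)) (s : ℝ), (∃ R, YBound F R) → (∃ R, YBound G R) →
        𝓚 π.1 π.2 (fun y => F y + s • G y) = fun y => 𝓚 π.1 π.2 F y + s • 𝓚 π.1 π.2 G y :=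
      fun π hπ => hK2 π.1 (hSm π hπ).1 π.2 (hSm π hπ).2
    have aK3 : ∀ R L t : ℝ, 0 < t → ∃ L' δ₀ : ℝ, 0 < δ₀ ∧ ∀ π ∈ S, ∀ F : EuclideanSpace ℝ (Fin 3) → EuclideanSpace ℝ (Fin 3),
        YBound F R → (∀ y, ‖y‖ ≤ L' → ‖F y‖ ≤ δ₀) → ∀ y, ‖y‖ ≤ L → ‖𝓚 π.1 π.2 F y‖ ≤ t ∧ ‖fderiv ℝ (𝓚 π.1 π.2 F) y‖ ≤ t := by
      intro R L t ht
      obtain ⟨L', δ₀, hδ₀, h3⟩ := htight R L t ht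
      exact ⟨L', δ₀, hδ₀, fun π hπ F hF hsm => (h3 π.1 (hSm π hπ).1 π.2 (hSm π hπ).2 F hF hsm).1⟩
    have aK4 : ∀ π ∈ S, ∀ (F : EuclideanSpace ℝ (Fin 3) → EuclideanSpace ℝ (Fin 3)) (R L t : ℝ), YBound F R → 0 < t →
        ∃ δ' > 0, ∀ π' ∈ S, dist π' π < δ' → LocClose (𝓚 π'.1 π'.2 F) (𝓚 π.1 π.2 F) L t := by
      intro π hπ F R L t hF ht
      obtain ⟨δ', hδ', h4⟩ := hgc π.1 (hSm π hπ).1 π.2 (hSm π hπ).2 F R L t hF ht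
      exact ⟨δ', hδ', fun π' hπ' hd => (h4 π'.1 (hSm π' hπ').1 π'.2 (hSm π' hπ').2 (dist_cubeWindow_lt hd).1 (dist_cubeWindow_lt hd).2).1⟩
    have ares : ∀ π ∈ S, YBound (r π.1 π.2) ε := fun π hπ => hres π.1 (hSm π hπ).1 π.2 (hSm π hπ).2
    have arc : ∀ π ∈ S, ∀ L t : ℝ, 0 < t → ∃ δ' > 0, ∀ π' ∈ S, dist π' π < δ' → ∀ y, ‖y‖ ≤ L → ‖r π'.1 π'.2 y - r π.1 π.2 y‖ ≤ t := by
      intro π hπ L t ht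
      obtain ⟨δ', hδ', hc⟩ := (hfamp π.1 (hSm π hπ).1).2.2 π.2 (hSm π hπ).2 L t ht
      exact ⟨δ', hδ', fun π' hπ' hd => (hc π'.1 (hSm π' hπ').1 π'.2 (hSm π' hπ').2 (dist_cubeWindow_lt hd).1 (dist_cubeWindow_lt hd).2).2.2.1⟩
    have aG : ∀ π ∈ S, YBound (G π.1 π.2) (2 * ε) ∧ ∀ y, G π.1 π.2 y = -r π.1 π.2 y - fderiv ℝ (𝓚 π.1 π.2 (G π.1 π.2)) y (𝓚 π.1 π.2 (G π.1 π.2) y) :=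
      fun π hπ => hG π.1 (hSm π hπ).1 π.2 (hSm π hπ).2
    -- (i) `π ↦ 𝓫_π G_π` is continuous on `S`
    have hcb : ContinuousOn (fun π : (Fin N → ℝ) × ℝ => 𝓫 π.1 π.2 (G π.1 π.2)) S := by
      refine continuousOn_functional_fixedPoint (S := S) (r := fun π => r π.1 π.2) (𝓚 := fun π => 𝓚 π.1 π.2) (ℓ := fun π => 𝓫 π.1 π.2)
        (G := fun π => G π.1 π.2) aK1 aK2 aK3 aK4 ares arc h16 hA0 ?_ ?_ ?_ ?_ aG
      · exact fun π hπ F R hF => ((hg12 π.1 (hSm π hπ).1 π.2 (hSm π hπ).2).1 F R hF).2.2.2.1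
      · exact fun π hπ F H s hF hH => ((hg12 π.1 (hSm π hπ).1 π.2 (hSm π hπ).2).2 F H s hF hH).2.1
      · intro R t ht
        obtain ⟨L', δ₀, hδ₀, h3⟩ := htight R 0 t ht
        exact ⟨L', δ₀, hδ₀, fun π hπ F hF hsm => (h3 π.1 (hSm π hπ).1 π.2 (hSm π hπ).2 F hF hsm).2.1⟩
      · intro π hπ F R t hF ht
        obtain ⟨δ', hδ', h4⟩ := hgc π.1 (hSm π hπ).1 π.2 (hSm π hπ).2 F R 0 t hF ht
        exact ⟨δ', hδ', fun π' hπ' hd => (h4 π'.1 (hSm π' hπ').1 π'.2 (hSm π' hπ').2 (dist_cubeWindow_lt hd).1 (dist_cubeWindow_lt hd).2).2.1⟩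
    -- (ii) `π ↦ 𝓬_π G_π j` is continuous on `S` for every `j`
    have hcc : ∀ j, ContinuousOn (fun π : (Fin N → ℝ) × ℝ => 𝓬 π.1 π.2 (G π.1 π.2) j) S := by
      intro j
      refine continuousOn_functional_fixedPoint (S := S) (r := fun π => r π.1 π.2) (𝓚 := fun π => 𝓚 π.1 π.2) (ℓ := fun π F => 𝓬 π.1 π.2 F j)
        (G := fun π => G π.1 π.2) aK1 aK2 aK3 aK4 ares arc h16 hA0 ?_ ?_ ?_ ?_ aG
      · exact fun π hπ F R hF => ((hg12 π.1 (hSm π hπ).1 π.2 (hSm π hπ).2).1 F R hF).2.2.2.2.1 j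
      · exact fun π hπ F H s hF hH => ((hg12 π.1 (hSm π hπ).1 π.2 (hSm π hπ).2).2 F H s hF hH).2.2 j
      · intro R t ht
        obtain ⟨L', δ₀, hδ₀, h3⟩ := htight R 0 t ht
        exact ⟨L', δ₀, hδ₀, fun π hπ F hF hsm => (h3 π.1 (hSm π hπ).1 π.2 (hSm π hπ).2 F hF hsm).2.2 j⟩
      · intro π hπ F R t hF ht
        obtain ⟨δ', hδ', h4⟩ := hgc π.1 (hSm π hπ).1 π.2 (hSm π hπ).2 F R 0 t hF ht
        exact ⟨δ', hδ', fun π' hπ' hd => (h4 π'.1 (hSm π' hπ').1 π'.2 (hSm π' hπ').2 (dist_cubeWindow_lt hd).1 (dist_cubeWindow_lt hd).2).2.2 j⟩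
    -- (iii) `g` and `G_j` are continuous on `S` (family's joint local continuity)
    have hcg : ContinuousOn (fun π : (Fin N → ℝ) × ℝ => g π.1 π.2) S := by
      rw [Metric.continuousOn_iff]
      intro π hπ t ht
      obtain ⟨δ', hδ', hc⟩ := (hfamp π.1 (hSm π hπ).1).2.2 π.2 (hSm π hπ).2 0 (t / 2) (by positivity)
      refine ⟨δ', hδ', fun π' hπ' hd => ?_⟩
      have h := (hc π'.1 (hSm π' hπ').1 π'.2 (hSm π' hπ').2 (dist_cubeWindow_lt hd).1 (dist_cubeWindow_lt hd).2).2.2.2.1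
      rw [Real.dist_eq]; linarith
    have hcG : ∀ j, ContinuousOn (fun π : (Fin N → ℝ) × ℝ => Gc π.1 π.2 j) S := by
      intro j
      rw [Metric.continuousOn_iff]
      intro π hπ t ht
      obtain ⟨δ', hδ', hc⟩ := (hfamp π.1 (hSm π hπ).1).2.2 π.2 (hSm π hπ).2 0 (t / 2) (by positivity)
      refine ⟨δ', hδ', fun π' hπ' hd => ?_⟩
      have h := (hc π'.1 (hSm π' hπ').1 π'.2 (hSm π' hπ').2 (dist_cubeWindow_lt hd).1 (dist_cubeWindow_lt hd).2).2.2.2.2 j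
      rw [Real.dist_eq]; linarith
    -- (iv) assemble on `S`, then pull back along the rescaling
    have hΦ : ContinuousOn (fun π : (Fin N → ℝ) × ℝ => (σ * (g π.1 π.2 - 𝓫 π.1 π.2 (G π.1 π.2)),
        fun j => Gc π.1 π.2 j - 𝓬 π.1 π.2 (G π.1 π.2) j)) S :=
      (continuousOn_const.mul (hcg.sub hcb)).prodMk (continuousOn_pi.2 fun j => (hcG j).sub (hcc j))
    have hψ : Continuous fun q : (Fin N → ℝ) × ℝ => ((q.1, β₀ * q.2) : (Fin N → ℝ) × ℝ) :=
      continuous_fst.prodMk (continuous_const.mul continuous_snd)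
    have hψm : MapsTo (fun q : (Fin N → ℝ) × ℝ => ((q.1, β₀ * q.2) : (Fin N → ℝ) × ℝ)) (cube ×ˢ Icc (-1) 1) S := by
      intro q hq
      rw [mem_prod] at hq
      refine (mem_cubeWindow_iff _).mpr ⟨hq.1, hwin q.2 hq.2⟩
    exact hΦ.comp hψ.continuousOn hψm
  · -- RATE FACES
    intro p hp
    have e1 : β₀ * (-1:ℝ) = -β₀ := mul_neg_one β₀
    have e2 : β₀ * (1:ℝ) = β₀ := mul_one β₀
    simp only [e1, e2]
    have hb1 := abs_lt.mp (hbq' p hp (-β₀) habs1)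
    have hb2 := abs_lt.mp (hbq' p hp β₀ habs2)
    by_cases hor : ∀ p : Fin N → ℝ, (∀ i, p i ∈ Icc (0:ℝ) 1) → g p (-β₀) ≤ -Γ ^ (-q₀) ∧ Γ ^ (-q₀) ≤ g p β₀
    · have hσ1 : σ = 1 := by rw [hσdef, if_pos hor]
      obtain ⟨h1, h2⟩ := hor p hp
      rw [hσ1]; constructor <;> linarith
    · have hσ1 : σ = -1 := by rw [hσdef, if_neg hor]
      obtain ⟨h1, h2⟩ := (hsign.resolve_left hor) p hp
      rw [hσ1]; constructor <;> linarith
  · -- THE BLOCK AT EVERY `(p, b)`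
    intro p b' hp hb'
    set β : ℝ := β₀ * b' with hβdef
    have hβ : |β| ≤ β₀ := hwin b' hb'
    obtain ⟨hU0s, hP0s, hdiv0, hU0X, hP0b, hy₀, hwaist, -, -, -, -, -, hexp, hresEq⟩ := (hfamp p hp).2.1 β hβ
    obtain ⟨hW, hQ1, hQb, -, -, hdivW, heq⟩ := (hg12 p hp β hβ).1 (G p β) _ (hG p hp β hβ).1
    -- the rate `αo = α⁰_p + β₀ b` is nonzero
    have hα₁ : α0 p + β ≠ 0 := by
      have hθα : θ₀ ≤ |α p| := (hcl.2 p hp).2.2.2.2.2.2.2.2.2.2.1.1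
      have hα0 : |α0 p - α p| ≤ θ₀ / 4 := (hfamp p hp).1
      intro h0
      have hα0eq : α0 p = -β := eq_neg_of_add_eq_zero_left h0
      have h1 : |α p| ≤ |α p - α0 p| + |α0 p| := by
        calc |α p| = |(α p - α0 p) + α0 p| := by congr 1; ring
          _ ≤ |α p - α0 p| + |α0 p| := abs_add_le _ _
      rw [abs_sub_comm] at h1
      rw [hα0eq, abs_neg] at h1
      rw [hα0eq] at hα0
      linarith [hβ.trans hβθ]
    obtain ⟨hne, hU2, hP1, hdiv, heqn, hdec, hPM, hwin'⟩ :=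
      boxConcl_point_of_fixedPoint (σ := σ) hU0s hP0s hdiv0 hU0X hP0b hy₀ hwaist hresEq hW hQ1 hQb hdivW heq (hG p hp β hβ).2 hσ
        (by rw [hAg, hε] at hhalf'; linarith) (by rw [hAg, hε] at hηΓ'; linarith)
    refine ⟨hα₁, hne, hU2, hP1, hdiv, fun y => heqn y, fun y => ?_, fun y => ?_, hwin', fun j => ⟨(hexp j).1, ?_⟩⟩
    · have := hdec y; rw [hAg, hε] at this ⊢; exact this
    · have := hPM y; rw [hAg, hε] at this ⊢; exact this
    · -- export transfer: `Γ·|B_j − kA_j F⁰| ≤ Γ·|G_j − kA_j F⁰| + Γ·|𝓬_j G| ≤ Cs + 1`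
      have h1 := (hexp j).2
      have h2 : Γ * |𝓬 p β (G p β) j| ≤ 1 :=
        (mul_le_mul_of_nonneg_left (hcB p hp β hβ j) hΓ0.le).trans (by rw [hAg, hε]; exact hexport)
      have htri : |Gc p β j - 𝓬 p β (G p β) j - kA p β j * areaDefect (deriv (w p j) (c p j)) (Aa p j (c p j))| ≤
          |Gc p β j - kA p β j * areaDefect (deriv (w p j) (c p j)) (Aa p j (c p j))| + |𝓬 p β (G p β) j| := by
        rw [show Gc p β j - 𝓬 p β (G p β) j - kA p β j * areaDefect (deriv (w p j) (c p j)) (Aa p j (c p j)) =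
          (Gc p β j - kA p β j * areaDefect (deriv (w p j) (c p j)) (Aa p j (c p j))) - 𝓬 p β (G p β) j by ring]
        exact abs_sub _ _
      calc Γ * |Gc p β j - 𝓬 p β (G p β) j - kA p β j * areaDefect (deriv (w p j) (c p j)) (Aa p j (c p j))|
          ≤ Γ * (|Gc p β j - kA p β j * areaDefect (deriv (w p j) (c p j)) (Aa p j (c p j))| + |𝓬 p β (G p β) j|) :=
            mul_le_mul_of_nonneg_left htri hΓ0.le
        _ = Γ * |Gc p β j - kA p β j * areaDefect (deriv (w p j) (c p j)) (Aa p j (c p j))| + Γ * |𝓬 p β (G p β) j| := by ring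
        _ ≤ Cs + 1 := add_le_add h1 h2

end Summit.NavierStokesRegularity.NavierStokesRegularity.Theorems.DefectColumnGate

end
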